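import Mathlib
import HarnessLib

/-!
# Hennig's finite-parameter candidate family for `n` aligned stationary vacuum black holes

Topic `Literature/Geometry/Lorentzian`, sub-namespace `Ernst` (definition request
`defn-Ernst.balanceCandidates`, crux `NoAnalyticParking` of `FinalStateConjecture/AnalyticInheritance`).

## Mathematical content

A (hypothetical) stationary, axisymmetric, asymptotically flat VACUUM equilibrium configuration of
`n` aligned rotating black holes with extended (sub-extremal) Killing horizons is described in
Weyl–Lewis–Papapetrou coordinates `(ρ, ζ)` by `n` horizon rods `𝓗ᵢ = [K₂ᵢ, K₂ᵢ₋₁]` on the `ζ`-axis,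
`K₁ > K₂ > ⋯ > K₂ₙ`, with angular velocities `Ωᵢ ≠ 0`, separated by axis segments `𝓐₁, …, 𝓐ₙ₊₁`
(`𝓐₁` the uppermost). Integrating the linear problem (LP) of the Ernst equation along `ρ = 0` and
around infinity (Neugebauer–Hennig 2009/2012 for `n = 2`, Hennig 2020 for all `n`) shows:

* the `2 × 2` "integration constants" of adjacent pieces of `ρ = 0` are linked at each pole `Kₘ` by
  the nilpotent factor `𝟙 ∓ Fₘ / (2iωₘ(K − Kₘ))`, `Fₘ = [[−fₘ, 1], [−fₘ², fₘ]]`, where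
  `fₘ = 𝓔(0, Kₘ) ∈ iℝ` is the (purely imaginary) value of the Ernst potential at the pole and `ωₘ`
  the angular velocity of the horizon the pole belongs to
  [NeugebauerHennig2012 §4.1; Hennig2020 §3];
* closing the contour forces the PARAMETER CONDITIONS: the matrix polynomial
  `r⁺(K) = [∏ₘ ((K − Kₘ)𝟙 + (−1)ᵐ⁺¹ Fₘ/(2iωₘ))] · P`, `P = [[0,1],[1,0]]`, is trace-free
  (poles numbered `m = 1, …, 2n` from the top here; the code numbers them `0, …, 2n − 1`, so the
  sign reads `(−1)ᵐ` there) [NeugebauerHennig2012 §4.1 and §4.4.3; Hennig2020 §3];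
* the Ernst potential on the upper axis is `𝓔⁺(ζ) = (π₂ₙ(ζ) − r⁺₁₁(ζ)) / r⁺₁₂(ζ)`,
  `π₂ₙ = ∏(ζ − Kₘ)` [NeugebauerHennig2012 §4.2], and — Hennig's main result — it REDUCES to a
  quotient `𝓔⁺ = πₙ / rₙ` of monic complex polynomials of degree `n` [Hennig2020 §3 (final result);
  Hennig2026 eq. (3)]; the potentials on the inner segments follow by the chain
  `ℓ ↦ ((K − Kₘ)𝟙 − (−1)ᵐ⁺¹Fₘ/(2iωₘ)) ℓ` from `ℓ⁺ = [[r⁺₁₂, 0], [−r⁺₁₁, π₂ₙ]]` and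
  `𝓔 = (ℓ₂₂ + ℓ₂₁)/(ℓ₁₁ + ℓ₁₂)` [NeugebauerHennig2012 §§4.1–4.2];
* per horizon, `κᵢ Aᵢ = 2π(K₂ᵢ₋₁ − K₂ᵢ)`, `Ωᵢ Mᵢ = (i/4)(f₂ᵢ₋₁ − f₂ᵢ)`,
  `Ωᵢ Jᵢ = Mᵢ/2 − (K₂ᵢ₋₁ − K₂ᵢ)/4`, `κᵢ + iΩᵢ = ½ ∂_ζ 𝓔^{𝓐ᵢ}(K₂ᵢ₋₁)`
  [NeugebauerHennig2009 (51)–(54)], and `M + iℓ` (ADM mass, NUT parameter) is read off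
  `𝓔⁺ = 1 − 2(M + iℓ)/ζ + O(ζ⁻²)` [NeugebauerHennig2009 (56)–(57); Hennig2019 §4].

Physically acceptable members must moreover be NUT-free, STRUT-free (`k = 0` on the inner axis
segments) and every horizon must satisfy the sub-extremality inequality `8π|Jᵢ| < Aᵢ`
[HennigAnsorgCederbaum2008; NeugebauerHennig2012 §6.1; Hennig2019 §1 (i)–(v); Hennig2026 §4].
For `n = 2` no member survives [NeugebauerHennig2009, NeugebauerHennig2012]; `n ≥ 3` is open
[Hennig2026 §4].

## What this file defines (all `noncomputable`, division-by-zero junk values as in Mathlib)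

`BalanceParams n` — the real coordinates: the non-leading coefficients of `πₙ, rₙ`, the poles `K`,
the angular velocities `Ω`, and the pole values `bₘ = Im 𝓔(0, Kₘ)` (Hennig 2020, §3: "algebraic
equations that restrict the allowed values for the quantities `𝓔₁,…,𝓔₂ₙ, K₁,…,K₂ₙ, Ω₁,…,Ωₙ`");
`rPlus`, `ParamConditions`, `AxisDataConsistent` (the identity `(π₂ₙ − r⁺₁₁)·rₙ = πₙ·r⁺₁₂` tying the
reduced axis data to the LP data), the chain `segmentMatrix` / `axisPotential`, `massNUT`,
`komarMass`, `angularMomentum`, `surfaceGravity`, `horizonArea`, `Subextremal`, the unimodular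
parameters `alpha m = conj(rₙ(Kₘ))/rₙ(Kₘ)` of the `2n`-soliton [NeugebauerHennig2012 §4.3],
the `n = 2` strut-freeness condition `α₁α₂ + α₃α₄ = 0` [NeugebauerHennig2012 §5], and
`balanceCandidates n StrutFree`, `balanceCandidatesTwo`. Every condition is a polynomial identity /
inequality in the coordinates (after clearing denominators; `surfaceGravity` is the derivative of an
explicit rational function), i.e. the candidate sets are SEMIALGEBRAIC. Sanity (`n = 1`): the Kerr
data `𝓔⁺ = (ζ − M − ia)/(ζ + M − ia)` [Hennig2019 §1] satisfy the parameter conditions and the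
consistency identity, with mass `M` and NUT parameter `0`, `½∂_ζ𝓔⁺(K₁) = κ + iΩ`, and a
sub-extremal Kerr black hole is a member of `balanceCandidates 1` (rational parametrisation
`M = p² + q², a = 2pq, √(M² − a²) = p² − q²`; the data `kerr` and `kerr_massNUT`, `kerr_nutFree` are
here, the remaining verification theorems in the companion file `ErnstBalanceCandidatesKerr.lean`).

## Design notes / what is NOT here

* STRUT-FREENESS is not a consequence of the Ernst/LP boundary data: it is the vanishing of the metric
  function `k` on the inner segments, whose closed form needs the explicit `2n`-soliton metric. It is
  printed for `n = 2` (Tomimatsu–Kihara / Manko–Ruiz / Kramer; [NeugebauerHennig2012 §5])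
  and vendored here as `strutFreeTwo`; for general `n` it is an ARGUMENT of `balanceCandidates`.
  TODO(general form): Manko–Ruiz, CQG 15 (1998) 2007, axis values of `e^{2γ}` of the extended
  `2N`-soliton (acquisition request acq-06648) — expressible in the coordinates `alpha`, `K` below.
* Degenerate horizons (`K₂ᵢ₋₁ = K₂ᵢ`, [HennigNeugebauer2011]), electrovacuum (`Φ ≠ 0`) and regularity
  OFF the axis (Hennig 2019 (v)) are not encoded; `Admissible` asks `K` strictly decreasing, `Ωᵢ ≠ 0`
  (Hennig 2020 §2) and `rₙ(Kₘ) ≠ 0` [NeugebauerHennig2012 §4.3, `r⁺₁₂(Kᵢ) ≠ 0`].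
* Indices are 0-based: pole `m : Fin (2n)` is `K_{m+1}`; horizon `i : Fin n` has top pole `2i` and
  bottom pole `2i+1`; segment `j : Fin (n+1)` is `𝓐_{j+1}` (so segment `i` lies above horizon `i`).
* The printed `n = 2` computations were re-derived numerically from these definitions (generic
  double-Kerr–NUT data and the Manko–Ruiz equilibrium family reproduce the printed `pᵢ = 8πJᵢ/Aᵢ`,
  [NeugebauerHennig2012 §6.1; NeugebauerHennig2009 eq. (68)]).

## References

* J. Hennig, Class. Quantum Grav. 37 (2020) 19LT01, arXiv:2009.03992. [Hennig2020]
* G. Neugebauer, J. Hennig, J. Geom. Phys. 62 (2012) 613, arXiv:1105.5830. [NeugebauerHennig2012]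
* G. Neugebauer, J. Hennig, Gen. Relativ. Gravit. 41 (2009) 2113, arXiv:0905.4179. [NeugebauerHennig2009]
* J. Hennig, Class. Quantum Grav. 36 (2019) 235001, arXiv:1906.04847. [Hennig2019]
* J. Hennig, J. Phys. Conf. Ser. 3177 (2026) 012022, arXiv:2604.12134. [Hennig2026]
* J. Hennig, M. Ansorg, C. Cederbaum, Class. Quantum Grav. 25 (2008) 162002. [HennigAnsorgCederbaum2008]
* V. S. Manko, E. Ruiz, Class. Quantum Grav. 18 (2001) L11. [MankoRuiz2001]
-/

noncomputable section

open Complex ComplexConjugate Matrix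

namespace Literature.Geometry.Lorentzian.Ernst

/-- **Coordinates of Hennig's candidate family** for `n` aligned rotating vacuum black holes:
the non-leading coefficients of the monic degree-`n` polynomials `πₙ` (`piCoeff k` = coefficient of
`ζᵏ`) and `rₙ` of the reduced upper-axis data `𝓔⁺ = πₙ/rₙ`, the poles `K₁ > ⋯ > K₂ₙ` (`K m`,
0-based), the horizon angular velocities `Ω₁, …, Ωₙ`, and the pole values `bₘ = Im 𝓔(0, Kₘ)` of the
Ernst potential (`𝓔(0, Kₘ) = i bₘ` is purely imaginary, [NeugebauerHennig2012 §4.1]).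
`9n` real coordinates; the constraints are in `balanceCandidates`.
[cite: Hennig2020, §3 (parameter conditions on 𝓔₁…𝓔₂ₙ, K₁…K₂ₙ, Ω₁…Ωₙ; final result 𝓔 = πₙ/rₙ)] -/
structure BalanceParams (n : ℕ) where
  /-- coefficient of `ζᵏ` (`k < n`) in the monic numerator `πₙ` of `𝓔⁺ = πₙ / rₙ` -/
  piCoeff : Fin n → ℂ
  /-- coefficient of `ζᵏ` (`k < n`) in the monic denominator `rₙ` -/
  rCoeff : Fin n → ℂ
  /-- pole positions (rod end points) `K m`, intended strictly decreasing in `m` -/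
  K : Fin (2 * n) → ℝ
  /-- angular velocity `Ω i` of the `i`-th horizon `[K (2i+1), K (2i)]` -/
  Ω : Fin n → ℝ
  /-- `b m = Im 𝓔(0, K m)`, the twist potential at the pole -/
  b : Fin (2 * n) → ℝ

namespace BalanceParams

variable {n : ℕ}

/-- Index of the top pole `K₂ᵢ₋₁` (0-based: `2i`) of horizon `i`. [cite: Hennig2020, §2 (Fig. 1)] -/
def top (i : Fin n) : Fin (2 * n) := ⟨2 * i.val, by omega⟩

/-- Index of the bottom pole `K₂ᵢ` (0-based: `2i+1`) of horizon `i`. [cite: Hennig2020, §2 (Fig. 1)] -/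
def bot (i : Fin n) : Fin (2 * n) := ⟨2 * i.val + 1, by omega⟩

/-- The horizon a pole belongs to (`ω₂ᵢ₋₁ = ω₂ᵢ = Ωᵢ`). [cite: Hennig2020, §3 (ω₂ᵢ₋₁ = ω₂ᵢ = Ωᵢ)] -/
def horizonOf (m : Fin (2 * n)) : Fin n := ⟨m.val / 2, by omega⟩

/-- `ωₘ`: the angular velocity attached to pole `m`. [cite: Hennig2020, §3 (ω₂ᵢ₋₁ = ω₂ᵢ = Ωᵢ)] -/
def omegaPole (p : BalanceParams n) (m : Fin (2 * n)) : ℝ := p.Ω (horizonOf m)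

/-- The reduced numerator `πₙ(ζ) = ζⁿ + Σ piCoeff k ζᵏ`. [cite: Hennig2020, §3 (final result 𝓔 = πₙ/rₙ)] -/
def piEval (p : BalanceParams n) (ζ : ℂ) : ℂ := ζ ^ n + ∑ k : Fin n, p.piCoeff k * ζ ^ (k : ℕ)

/-- The reduced denominator `rₙ(ζ) = ζⁿ + Σ rCoeff k ζᵏ`. [cite: Hennig2020, §3 (final result 𝓔 = πₙ/rₙ)] -/
def rEval (p : BalanceParams n) (ζ : ℂ) : ℂ := ζ ^ n + ∑ k : Fin n, p.rCoeff k * ζ ^ (k : ℕ)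

/-- `π₂ₙ(ζ) = ∏ₘ (ζ − Kₘ)`. [cite: Hennig2020, §3 (π₂ₙ = (ζ − K₁)⋯(ζ − K₂ₙ))] -/
def polePoly (p : BalanceParams n) (ζ : ℂ) : ℂ := ∏ m : Fin (2 * n), (ζ - (p.K m : ℂ))

/-- The nilpotent pole matrix `Fₘ = [[−fₘ, 1], [−fₘ², fₘ]]` with `fₘ = i bₘ`
(`= −Mₘ` of Hennig 2020 in vacuum). [cite: NeugebauerHennig2012, §4.1 (matrices 𝐅ᵢ); Hennig2020 §3 (𝐌ₖ)] -/
def Fmat (p : BalanceParams n) (m : Fin (2 * n)) : Matrix (Fin 2) (Fin 2) ℂ :=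
  !![-(I * (p.b m : ℂ)), 1; (p.b m : ℂ) ^ 2, I * (p.b m : ℂ)]

/-- The sheet-exchange matrix `P = [[0, 1], [1, 0]]`. [cite: NeugebauerHennig2012, §4.1 (𝐋⁻ = P 𝐋⁺ P); Hennig2020 §3 (matrix 𝐏)] -/
def swap : Matrix (Fin 2) (Fin 2) ℂ := !![0, 1; 1, 0]

/-- The coefficient `(−1)ᵐ / (2 i ωₘ)` of `Fₘ` in the `m`-th factor of `r⁺` (0-based `m`; `+` at top
poles, `−` at bottom poles). [cite: NeugebauerHennig2012, §4.1 (definition of 𝐑⁺); Hennig2020 §3 (αₖ, 𝐁-formula)] -/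
def coupling (p : BalanceParams n) (m : Fin (2 * n)) : ℂ := (-1) ^ m.val / (2 * I * (p.omegaPole m : ℂ))

/-- The `m`-th factor `(ζ − Kₘ)𝟙 + (−1)ᵐ Fₘ/(2iωₘ)` of `r⁺(ζ)` (the factor of `R⁺` multiplied by
`ζ − Kₘ`). [cite: NeugebauerHennig2012, §4.1 (definition of 𝐑⁺)] -/
def rPlusFactor (p : BalanceParams n) (m : Fin (2 * n)) (ζ : ℂ) : Matrix (Fin 2) (Fin 2) ℂ :=
  (ζ - (p.K m : ℂ)) • (1 : Matrix (Fin 2) (Fin 2) ℂ) + p.coupling m • p.Fmat m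

/-- `r⁺(ζ) = [∏ₘ ((ζ − Kₘ)𝟙 + (−1)ᵐ Fₘ/(2iωₘ))] · P = R⁺(ζ) · π₂ₙ(ζ)`, ordered product from the top
pole `m = 0` (leftmost) to the bottom pole `2n−1`.
[cite: NeugebauerHennig2012, §4.1 (𝐑⁺), §4.2 (𝐫⁺ = 𝐑⁺ ∏(ζ − Kₗ)), §4.4.3 (general n); Hennig2020 §3 (𝐁-formula)] -/
def rPlus (p : BalanceParams n) (ζ : ℂ) : Matrix (Fin 2) (Fin 2) ℂ :=
  (List.ofFn fun m : Fin (2 * n) => p.rPlusFactor m ζ).prod * swap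

/-- **Hennig's parameter conditions**: `r⁺(ζ)` is trace-free identically in `ζ` (equivalently
`(R⁺)² = 𝟙`, equivalently Hennig's `3 × 3` matrix identity in vacuum; a polynomial identity of degree
`≤ 2n − 1` in `ζ`, i.e. finitely many polynomial equations in the coordinates).
[cite: NeugebauerHennig2012, §4.1 (tr 𝐑⁺ = 0), §4.2 (⇔ det(𝐑⁺ − 𝟙) = 0), §4.4.3; Hennig2020 §3 (parameter conditions)] -/
def ParamConditions (p : BalanceParams n) : Prop := ∀ ζ : ℂ, (p.rPlus ζ).trace = 0

/-- Numerator `π₂ₙ − r⁺₁₁` of the (unreduced) upper-axis potential. [cite: NeugebauerHennig2012, §4.2 (f⁺ = (∏(ζ − Kₗ) − r⁺₁₁)/r⁺₁₂)] -/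
def upperNum (p : BalanceParams n) (ζ : ℂ) : ℂ := p.polePoly ζ - p.rPlus ζ 0 0

/-- Denominator `r⁺₁₂` of the (unreduced) upper-axis potential. [cite: NeugebauerHennig2012, §4.2 (f⁺ = (∏(ζ − Kₗ) − r⁺₁₁)/r⁺₁₂)] -/
def upperDen (p : BalanceParams n) (ζ : ℂ) : ℂ := p.rPlus ζ 0 1

/-- **Consistency of the reduced axis data**: `(π₂ₙ − r⁺₁₁) · rₙ = πₙ · r⁺₁₂` identically, i.e.
`𝓔⁺ = (π₂ₙ − r⁺₁₁)/r⁺₁₂ = πₙ/rₙ` (Hennig: at least `n` linear factors cancel).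
[cite: Hennig2020, §3 (𝓔 = Q₂ₙ/p₂ₙ reduces to πₙ/rₙ); NeugebauerHennig2012 §4.2 (f⁺ = n₂/d₂)] -/
def AxisDataConsistent (p : BalanceParams n) : Prop := ∀ ζ : ℂ, p.upperNum ζ * p.rEval ζ = p.piEval ζ * p.upperDen ζ

/-- The factor `(ζ − Kₘ)𝟙 − (−1)ᵐ Fₘ/(2iωₘ)` carrying the LP data DOWN across pole `m`
(inverse of the `m`-th factor of `R⁺` up to the scalar `ζ − Kₘ`, since `Fₘ² = 0`).
[cite: NeugebauerHennig2012, §4.1 (chain of 𝐋-matrices); Hennig2020 §3 (relations between 𝐂ⱼ, 𝐃ⱼ)] -/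
def chainFactor (p : BalanceParams n) (m : Fin (2 * n)) (ζ : ℂ) : Matrix (Fin 2) (Fin 2) ℂ :=
  (ζ - (p.K m : ℂ)) • (1 : Matrix (Fin 2) (Fin 2) ℂ) - p.coupling m • p.Fmat m

/-- `chain k ζ`: the (polynomially rescaled) LP matrix on the piece of `ρ = 0` reached after crossing
the first `k` poles, starting from `ℓ⁺ = [[r⁺₁₂, 0], [−r⁺₁₁, π₂ₙ]]` on `𝓐₁` (standard gauge
`L⁺ = [[F, 0], [G, 1]]`, `F = R⁺₁₂`, `G = −R⁺₁₁`).
[cite: NeugebauerHennig2012, §4.1 (factorisation of 𝐋⁺, chain), §4.2 (standard gauge)] -/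
def chain (p : BalanceParams n) : ℕ → ℂ → Matrix (Fin 2) (Fin 2) ℂ
  | 0, ζ => !![p.upperDen ζ, 0; -(p.rPlus ζ 0 0), p.polePoly ζ]
  | k + 1, ζ => if h : k < 2 * n then p.chainFactor ⟨k, h⟩ ζ * chain p k ζ else chain p k ζ

/-- LP matrix on the axis segment `𝓐_{j+1}` (after `2j` poles). [cite: NeugebauerHennig2012, §4.1 (chain of 𝐋-matrices), §4.4.3] -/
def segmentMatrix (p : BalanceParams n) (j : Fin (n + 1)) (ζ : ℂ) : Matrix (Fin 2) (Fin 2) ℂ := p.chain (2 * j.val) ζ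

/-- Ernst potential on the axis segment `𝓐_{j+1}`: `𝓔 = (D + C)/(A + B)` for `L = [[A, B], [C, D]]`
(rational in `ζ`; `j = 0` gives `𝓔⁺ = (π₂ₙ − r⁺₁₁)/r⁺₁₂`). [cite: NeugebauerHennig2012, §4.2 (axis values f = (D + C)/(A + B))] -/
def axisPotential (p : BalanceParams n) (j : Fin (n + 1)) (ζ : ℂ) : ℂ :=
  (p.segmentMatrix j ζ 1 1 + p.segmentMatrix j ζ 1 0) / (p.segmentMatrix j ζ 0 0 + p.segmentMatrix j ζ 0 1)

/-- The upper-axis Ernst potential `𝓔⁺(ζ) = 𝓔(ρ = 0, ζ)`, `ζ > K₁`. [cite: NeugebauerHennig2012, §4.2 (f⁺); Hennig2020 §3] -/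
def upperAxisPotential (p : BalanceParams n) (ζ : ℂ) : ℂ := p.axisPotential 0 ζ

/-- Coefficient of `ζⁿ⁻¹` of a monic degree-`n` polynomial given by its lower coefficients
(`0` for `n = 0`). [folklore] -/
def subleading (c : Fin n → ℂ) : ℂ := if h : 0 < n then c ⟨n - 1, by omega⟩ else 0

/-- `M + iℓ` (ADM mass and NUT parameter) from `𝓔⁺ = πₙ/rₙ = 1 − 2(M + iℓ)/ζ + O(ζ⁻²)`:
`2(M + iℓ) = (coeff. of ζⁿ⁻¹ in rₙ) − (coeff. of ζⁿ⁻¹ in πₙ)`.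
[cite: Hennig2019, §4 (asymptotics of 𝓔₊, NUT constraint); NeugebauerHennig2009 eqs. (56)–(57)] -/
def massNUT (p : BalanceParams n) : ℂ := (subleading p.rCoeff - subleading p.piCoeff) / 2

/-- ADM mass `M`. [cite: NeugebauerHennig2009, eq. (57)] -/
def admMass (p : BalanceParams n) : ℝ := p.massNUT.re

/-- NUT parameter `ℓ`. [cite: Hennig2019, §4 (NUT constraint Im(c₁ + c₂ − d₁ − d₂) = 0)] -/
def nutParameter (p : BalanceParams n) : ℝ := p.massNUT.im

/-- NUT-freeness `ℓ = 0`. [cite: Hennig2019, §1 condition (i) and §4; Hennig2026 §4] -/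
def NutFree (p : BalanceParams n) : Prop := p.nutParameter = 0

/-- Komar mass of horizon `i`: `Ωᵢ Mᵢ = (i/4)(f_top − f_bot) = (b_bot − b_top)/4`.
[cite: NeugebauerHennig2009, eq. (52)] -/
def komarMass (p : BalanceParams n) (i : Fin n) : ℝ := (p.b (bot i) - p.b (top i)) / (4 * p.Ω i)

/-- Angular momentum of horizon `i`: `Ωᵢ Jᵢ = Mᵢ/2 − (K_top − K_bot)/4`.
[cite: NeugebauerHennig2009, eq. (53)] -/
def angularMomentum (p : BalanceParams n) (i : Fin n) : ℝ :=
  (p.komarMass i / 2 - (p.K (top i) - p.K (bot i)) / 4) / p.Ω i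

/-- `½ ∂_ζ 𝓔^{𝓐ᵢ}` at the top pole of horizon `i` (`= κᵢ + iΩᵢ`), the derivative of the axis potential
of the segment above the horizon. [cite: NeugebauerHennig2009, eq. (54)] -/
def halfDeriv (p : BalanceParams n) (i : Fin n) : ℂ :=
  deriv (fun t : ℝ => p.axisPotential (Fin.castSucc i) (t : ℂ)) (p.K (top i)) / 2

/-- Surface gravity `κᵢ = Re ½ ∂_ζ 𝓔^{𝓐ᵢ}(K_top)`. [cite: NeugebauerHennig2009, eq. (54)] -/
def surfaceGravity (p : BalanceParams n) (i : Fin n) : ℝ := (p.halfDeriv i).re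

/-- Horizon area from `κᵢ Aᵢ = 2π (K_top − K_bot)`. [cite: NeugebauerHennig2009, eq. (51)] -/
def horizonArea (p : BalanceParams n) (i : Fin n) : ℝ := 2 * Real.pi * (p.K (top i) - p.K (bot i)) / p.surfaceGravity i

/-- Sub-extremality of every horizon: `8π|Jᵢ| < Aᵢ` (trapped surfaces just inside the horizon).
[cite: HennigAnsorgCederbaum2008, Theorem (eq. (1)); NeugebauerHennig2012 §6.1 (8π|Jᵢ| < Aᵢ, i = 1, 2)] -/
def Subextremal (p : BalanceParams n) : Prop := ∀ i : Fin n, 8 * Real.pi * |p.angularMomentum i| < p.horizonArea i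

/-- Non-degeneracy: poles strictly ordered `K₁ > ⋯ > K₂ₙ` (extended, disjoint horizons), `Ωᵢ ≠ 0`,
and `rₙ(Kₘ) ≠ 0`. [cite: Hennig2020, §2 (Ωᵢ ≠ 0); NeugebauerHennig2012 §4.3 (K₁ > K₂ > K₃ > K₄; r⁺₁₂(Kᵢ) ≠ 0)] -/
def Admissible (p : BalanceParams n) : Prop :=
  StrictAnti p.K ∧ (∀ i : Fin n, p.Ω i ≠ 0) ∧ ∀ m : Fin (2 * n), p.rEval (p.K m) ≠ 0

/-- The unimodular `2n`-soliton parameter `αₘ = conj(rₙ(Kₘ)) / rₙ(Kₘ)` (`|αₘ| = 1`;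
`βₘ = conj(πₙ(Kₘ))/πₙ(Kₘ) = −αₘ`). [cite: NeugebauerHennig2012, §4.3 (α(ζ) = d̄₂/d₂, αᵢ = α(Kᵢ), βᵢ = −αᵢ)] -/
def alpha (p : BalanceParams n) (m : Fin (2 * n)) : ℂ := conj (p.rEval (p.K m)) / p.rEval (p.K m)

end BalanceParams

/-- **Strut-freeness for `n = 2`** (no conical singularity on the axis segment between the two
horizons, `e^{2k⁰} = 1`, branch `H⁰ = −H⁺`): `α₁α₂ + α₃α₄ = 0`, written denominator-free as
`conj(r(K₁)) conj(r(K₂)) r(K₃) r(K₄) + r(K₁) r(K₂) conj(r(K₃)) conj(r(K₄)) = 0`.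
[cite: NeugebauerHennig2012, §5 (e^{2k⁰} = 1 ⇒ α₁α₂ + α₃α₄ = 0) and §6.1; MankoRuiz2001] -/
def strutFreeTwo (p : BalanceParams 2) : Prop :=
  conj (p.rEval (p.K 0)) * conj (p.rEval (p.K 1)) * p.rEval (p.K 2) * p.rEval (p.K 3)
    + p.rEval (p.K 0) * p.rEval (p.K 1) * conj (p.rEval (p.K 2)) * conj (p.rEval (p.K 3)) = 0

/-- **Candidate set for the `n`-black-hole balance problem** (semialgebraic): admissible coordinates
satisfying Hennig's parameter conditions, consistency of the reduced axis data `πₙ/rₙ`, NUT-freeness,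
the strut-freeness predicate `StrutFree` (closed form printed only for `n = 2`, see `strutFreeTwo`
and the module docstring), and sub-extremality `8π|Jᵢ| < Aᵢ` of all `n` horizons (which, as
`Aᵢ = 2π(K_top − K_bot)/κᵢ` with `K_top > K_bot`, forces `κᵢ > 0`). The LP/axis data of a stationary
equilibrium configuration of `n` aligned rotating sub-extremal vacuum black holes (regular, strut-free
axis, NUT-free) is a point of this set (for the true strut condition); Hennig's reformulation of the
balance problem — open for `n ≥ 3` — is whether the set is empty.
[cite: Hennig2020, §§3–4; Hennig2026 §§3–4; NeugebauerHennig2009 §3.1; NeugebauerHennig2012 §6.1] -/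
def balanceCandidates (n : ℕ) (StrutFree : BalanceParams n → Prop) : Set (BalanceParams n) :=
  {p | p.Admissible ∧ p.ParamConditions ∧ p.AxisDataConsistent ∧ p.NutFree ∧ StrutFree p ∧
    p.Subextremal}

/-- The `n = 2` candidate set with the printed strut condition; Neugebauer–Hennig prove it is empty
(every strut-free candidate violates `8π|Jᵢ| < Aᵢ` for some `i`).
[cite: NeugebauerHennig2012, §§5–6.1; NeugebauerHennig2009 §4] -/
def balanceCandidatesTwo : Set (BalanceParams 2) := balanceCandidates 2 strutFreeTwo

/-! ## Sanity check `n = 1`: the Kerr axis data -/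

/-- Kerr LP data in the rational parametrisation `M = p² + q²`, `a = 2pq`, `σ = √(M² − a²) = p² − q²`,
`r₊ = M + σ = 2p²`: `π₁ = ζ − M − ia`, `r₁ = ζ + M − ia`, poles `±σ`, `Ω = a/(2Mr₊)`,
pole values `b = (−a/r₊, +a/r₊)`. [cite: Hennig2019, §1 (Kerr–Newman axis data, Q = 0); NeugebauerHennig2009 eqs. (51)–(54)] -/
def kerr (p q : ℝ) : BalanceParams 1 where
  piCoeff := ![-((p : ℂ) ^ 2 + q ^ 2 + I * (2 * p * q))]
  rCoeff := ![(p : ℂ) ^ 2 + q ^ 2 - I * (2 * p * q)]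
  K := ![p ^ 2 - q ^ 2, -(p ^ 2 - q ^ 2)]
  Ω := ![q / (2 * p * (p ^ 2 + q ^ 2))]
  b := ![-(q / p), q / p]

/-- The Kerr data have ADM mass `M = p² + q²` and NUT parameter `0`. [cite: Hennig2019, §1 (Kerr–Newman axis data) and §4 (asymptotics)] -/
theorem kerr_massNUT (p q : ℝ) : (kerr p q).massNUT = (p : ℂ) ^ 2 + q ^ 2 := by
  simp [BalanceParams.massNUT, BalanceParams.subleading, kerr]
  ring

/-- The Kerr data are NUT-free. [cite: Hennig2019, §4] -/
theorem kerr_nutFree (p q : ℝ) : (kerr p q).NutFree := by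
  simp only [BalanceParams.NutFree, BalanceParams.nutParameter, kerr_massNUT]
  simp [Complex.add_im, pow_two]

end Literature.Geometry.Lorentzian.Ernst
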